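import Literature.NumberTheory.ComplexMultiplication.CMTypeHarrisTaylorSignatureReflexFieldCompositum
import Literature.NumberTheory.ComplexMultiplication.KottwitzSignatureReflexField
import HarnessLib

/-!
# The field `ℚ(tr_Φ(a) ∣ a ∈ k₀)` generated by the type traces of a SUBFIELD `k₀ ≤ K`: it is Kottwitz's reflex field of the
# `k₀`-signature `m_ψ = #{φ ∈ Φ ∣ φ|_{k₀} = ψ}` of `Φ` (`Aut(ℂ/ℚ(tr_Φ(k₀))) = Stab(m)`), it lies in `K*`, and under the
# Kottwitz condition of signature `((1, n−1)_{φ₀}, (0, n)_{ψ ∈ Φ₀ ∖ {φ₀}})` (`n = [K : k₀] ≥ 3`, `K` CM) it IS the reflex field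
# `E = E_{Φ₀} · φ₀(k₀)` of the Rapoport–Smithling–Zhang datum `(k₀, Φ₀, φ₀)`

Layer `Literature/NumberTheory/ComplexMultiplication`, namespace `Literature.NumberTheory.ComplexMultiplication` (lane
`lit-hodgefound`, Track 2 foundations, Layer A3; seat `lit-hodgefound-p11`, generation 28, row g28-#5).  Sequel of
`KottwitzSignatureReflexField` (g28-#4: `E_r = ℚ(∑_φ r_φ φ(a))`, `Aut(ℂ/E_r) = Stab(r)`) and
`CMTypeHarrisTaylorSignatureReflexFieldCompositum` (g28-#2: `K* = E_{Φ₀} · σ₀(K)`, `Stab(Φ) = Stab(m) ∩ Stab(σ₀)`).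
THEOREMS ONLY (D-0026): the field is WRITTEN OUT as
`IntermediateField.adjoin ℚ (Set.range fun a : k₀ => cmTypeTrace Φ (algebraMap k₀ K a))`.

THE PRINT.  R. E. Kottwitz (1992) [Kottwitz1992] §5 pp. 389–390: «Let `E ⊂ ℂ` be the field of definition of the
isomorphism class of the complex representation `V₁` of `B`; the number field `E` is called the reflex field» — here for
the datum `B = k₀` acting on `H₁(A, ℚ)` of a CM abelian variety of type `(K, Φ)`: `V₁ = Lie(A) ≅ ⊕_{φ ∈ Φ} φ`, whose class
as a `k₀ ⊗ ℂ`-module is the `k₀`-signature `m`, and `tr(a ∣ V₁) = ∑_ψ m_ψ ψ(a) = ∑_{φ ∈ Φ} φ(a) = tr_Φ(a)` for `a ∈ k₀`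
(G. Shimura (1998) [Shimura1998] §5.2 p. 39: «`M` restricted to `F` is equivalent to the direct sum of the `φᵢ`»; §8.3
Prop. 28: `K* = ℚ(tr_Φ(ξ) ∣ ξ ∈ K)`).  M. Rapoport, B. Smithling, W. Zhang [RapoportSmithlingZhang2017] Introduction p. 2
(«`r : Hom(F, ℂ) → {0, 1, n−1, n}` […] the field `E ⊂ ℚ̄` which is the composite of the reflex field of `r` and the reflex
field of `Φ`»), §3.1 eq. (3.1) (`Aut(ℂ/E) = {σ ∣ σΦ = Φ, σφ₀ = φ₀}`), §3.2 p. 10 (the moduli problem OVER `E`: «`ι : F → End⁰(A)`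
[…] satisfying the Kottwitz condition of signature `((1, n−1)_{φ₀}, (0, n)_{φ ∈ Φ ∖ {φ₀}})`»).  B. Howard (2012) [Howard2012]
§3.1.  S. Lang [Lang2002] VIII §1.

WHAT IS PROVED (`K` a number field, `k₀ : IntermediateField ℚ K`, `Φ : CMType K`, `m_ψ` written out as
`{φ | φ ∈ Φ.1 ∧ φ.comp (algebraMap k₀ K) = ψ}.ncard`, `E_{m} := ℚ(tr_Φ(a) ∣ a ∈ k₀)` as displayed):

§1 `adjoin_cmTypeTrace_algebraMap_eq_adjoin_sum` (`ℚ(tr_Φ(k₀)) = E_m`, Kottwitz's reflex field of the signature: `∑_ψ m_ψ ψ(a) = tr_Φ(a)`),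
   `adjoin_cmTypeTrace_algebraMap_le_traceField` (`⊆ K*`), **`forall_mem_adjoin_cmTypeTrace_algebraMap_iff`** (`Aut(ℂ/ℚ(tr_Φ(k₀))) = Stab(m)`),
   `mem_adjoin_cmTypeTrace_algebraMap_iff_forall` (the fixed field of `Stab(m)`), finiteness and `[ℚ(tr_Φ(k₀)) : ℚ] ∣ [K* : ℚ]`,
   monotonicity in `k₀` (`adjoin_cmTypeTrace_algebraMap_mono`).
§2 (`K` CM, the Kottwitz condition of `Φ` relative to `(Φ₀, φ₀)`: `hφ₀ : φ₀ ∈ Φ₀`, `h1 : m_{φ₀} = 1`, `hΦ₀ : m = 0` on `Φ₀ ∖ {φ₀}`)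
   `ncard_inter_fibre_smul_eq_of_forall_smul_mem_iff_base_of_smul_eq` (`τΦ₀ = Φ₀ ∧ τφ₀ = φ₀ ⟹ m ∘ τ = m`, any `n`: complex
   conjugation commutes with `Aut(ℂ)` on `Hom(k₀, ℂ)` because `k₀ ≤ K` with `K` CM), **`adjoin_cmTypeTrace_algebraMap_sup_eq_of_rsz`**
   (`ℚ(tr_Φ(k₀)) · E_{Φ₀} = E_{Φ₀} · φ₀(k₀) = E`, any `n`), and for `n ≥ 3` **`adjoin_cmTypeTrace_algebraMap_eq_of_rsz`:
   `ℚ(tr_Φ(a) ∣ a ∈ k₀) = E_{Φ₀} · φ₀(k₀)`** — RSZ's REFLEX FIELD IS GENERATED BY THE TYPE TRACES OF THE ELEMENTS OF `k₀` = `F`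
   (for the type of ANY CM point of the moduli problem), whence `traceField_base_le_adjoin_cmTypeTrace_algebraMap_of_rsz`
   (`E_{Φ₀} ⊆ ℚ(tr_Φ(k₀))`), `apply_mem_adjoin_cmTypeTrace_algebraMap_of_rsz` (`φ₀(a) ∈ ℚ(tr_Φ(k₀))`: the distinguished
   embedding is a rational function of the type traces), `adjoin_cmTypeTrace_algebraMap_le_traceField_iff`-type degree facts, and
   through the Harris–Taylor hypotheses `(h1, hban)`: `exists_cmType_adjoin_cmTypeTrace_algebraMap_eq_of_harrisTaylor`.

## References

* [Kottwitz1992] R. E. Kottwitz, *Points on some Shimura varieties over finite fields*, JAMS 5 (1992), §5 pp. 389–390.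
* [RapoportSmithlingZhang2017] M. Rapoport, B. Smithling, W. Zhang, *Arithmetic diagonal cycles on unitary Shimura
  varieties*, Compositio Math. 156 (2020); arXiv:1710.06962v3 Introduction p. 2, §3.1 eq. (3.1), §3.2 p. 10.
* [Shimura1998] G. Shimura, *Abelian Varieties with Complex Multiplication and Modular Functions* (1998), §5.2 p. 39, §8.3
  Prop. 28.
* [Howard2012] B. Howard, Ann. of Math. (2) 176 (2012), §3.1.
* [Lang2002] S. Lang, *Algebra* (2002), VIII §1.
* [MilneFT2022] J. S. Milne, *Fields and Galois Theory* (2022), Prop. 1.20, Prop. 2.7.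

## Provenance

Lane `lit-hodgefound` (HOME `run/shared/lean/pub/lit-hodgefound/`), prover seat `lit-hodgefound-p11` (gen 28),
self-proposed row g28-#5 (lane INBOX claim 2026-08-27), sequel of g28-#2 and g28-#4.
-/

set_option autoImplicit false

noncomputable section

open scoped Cardinal Classical Pointwise
open NumberField Module IntermediateField

namespace Literature.NumberTheory.ComplexMultiplication

open Literature.AlgebraicGeometry.Motives (CMType)
open Literature.AlgebraicGeometry.Motives.HodgeStructure (cmTypeSmul cmTypeSmul_val)
open Literature.FieldTheory.AlgClosed (Complex.mem_subfield_of_forall_ringEquiv)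

variable {K : Type} [Field K] [NumberField K] (k₀ : IntermediateField ℚ K)

/-! ## §0 Preliminaries -/

section Prelim

/-- `(τφ)|_{k₀} = τ(φ|_{k₀})`. [folklore] -/
private theorem smul_comp_st (τ : ℂ ≃+* ℂ) (φ : K →+* ℂ) :
    (τ • φ).comp (algebraMap k₀ K) = τ • φ.comp (algebraMap k₀ K) :=
  RingHom.ext fun _ => rfl

/-- `φ̄|_{k₀} = \overline{φ|_{k₀}}`. [folklore] -/
private theorem conjugate_comp_st (φ : K →+* ℂ) :
    (ComplexEmbedding.conjugate φ).comp (algebraMap k₀ K) = ComplexEmbedding.conjugate (φ.comp (algebraMap k₀ K)) :=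
  (conjugate_comp_ringHom (algebraMap k₀ K) φ).symm

/-- Every embedding of `k₀` extends to `K`. [cite: MilneFT2022, Prop. 2.7 (a)] -/
private theorem exists_comp_eq_st (ψ : k₀ →+* ℂ) : ∃ φ : K →+* ℂ, φ.comp (algebraMap k₀ K) = ψ := by
  have h := ncard_fibre_eq_finrank k₀ (K := K) ψ
  have hpos : 0 < {φ : K →+* ℂ | φ.comp (algebraMap k₀ K) = ψ}.ncard := by rw [h]; exact Module.finrank_pos
  obtain ⟨φ, hφ⟩ := Set.nonempty_of_ncard_ne_zero hpos.ne'
  exact ⟨φ, hφ⟩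

/-- `τφ̄ = \overline{τφ}` on the embeddings of a CM field. [cite: Shimura1998, §18.2 Lemma (i)] -/
private theorem smul_conjugate_st [IsCMField K] (τ : ℂ ≃+* ℂ) (φ : K →+* ℂ) :
    τ • ComplexEmbedding.conjugate φ = ComplexEmbedding.conjugate (τ • φ) := by
  refine RingHom.ext fun x => ?_
  change τ (starRingEnd ℂ (φ x)) = starRingEnd ℂ (τ (φ x))
  rw [← IsCMField.complexEmbedding_complexConj K φ x]
  exact IsCMField.complexEmbedding_complexConj K ((τ : ℂ →+* ℂ).comp φ) x

/-- `τψ̄ = \overline{τψ}` for `ψ : k₀ → ℂ`, `k₀ ≤ K` with `K` CM (restrict along an extension of `ψ`). [cite: Shimura1998, §18.2 Lemma (i)] -/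
private theorem smul_conjugate_base_st [IsCMField K] (τ : ℂ ≃+* ℂ) (ψ : k₀ →+* ℂ) :
    τ • ComplexEmbedding.conjugate ψ = ComplexEmbedding.conjugate (τ • ψ) := by
  obtain ⟨φ, rfl⟩ := exists_comp_eq_st k₀ ψ
  rw [← conjugate_comp_st, ← smul_comp_st, smul_conjugate_st, ← smul_comp_st, conjugate_comp_st]

/-- `conj ∘ conj = id` on complex embeddings. [folklore] -/
private theorem conjugate_conjugate_st {E : Type} [Field E] (φ : E →+* ℂ) :
    ComplexEmbedding.conjugate (ComplexEmbedding.conjugate φ) = φ :=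
  RingHom.ext fun x => by rw [ComplexEmbedding.conjugate_coe_eq, ComplexEmbedding.conjugate_coe_eq, Complex.conj_conj]

/-- `tr_Φ(x) = ∑_{s ∈ Φ} s(x)` over the subtype `Φ`. [cite: Shimura1998, §8.3 Prop. 28] -/
private theorem cmTypeTrace_eq_sum_subtype_st (Φ : CMType K) [Fintype Φ.1] (x : K) :
    cmTypeTrace Φ x = ∑ s : Φ.1, (s.1 : K →+* ℂ) x := by
  rw [cmTypeTrace_apply]
  exact Finset.sum_subtype _ (fun φ => (Set.toFinite Φ.1).mem_toFinset) _

/-- The multiplicity `m_ψ` as a subtype cardinality. [folklore] -/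
private theorem ncard_inter_fibre_eq_card_fibre_st (Φ : CMType K) (ψ : k₀ →+* ℂ) [Fintype Φ.1] :
    {φ : K →+* ℂ | φ ∈ Φ.1 ∧ φ.comp (algebraMap k₀ K) = ψ}.ncard =
      Fintype.card {σ : Φ.1 // σ.1.comp (algebraMap k₀ K) = ψ} := by
  rw [← Nat.card_coe_set_eq, Fintype.card_eq_nat_card]
  exact Nat.card_congr
    (Equiv.subtypeSubtypeEquivSubtypeInter (fun φ : K →+* ℂ => φ ∈ Φ.1)
      (fun φ => φ.comp (algebraMap k₀ K) = ψ)).symm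

/-- **`∑_ψ m_ψ ψ(a) = tr_Φ(a)` for `a ∈ k₀`** (sum over the fibres of `Φ → Hom(k₀, ℂ)`; the public copy lives in the
pair file `EndomorphismFieldSubfieldSignatureReflexField.sum_ncard_mul_apply_eq_cmTypeTrace`, not imported here).
[cite: Shimura1998, §5.2 p. 39; §8.3 Prop. 28] -/
private theorem sum_ncard_mul_apply_eq_cmTypeTrace_st (Φ : CMType K) (a : k₀) :
    ∑ ψ : k₀ →+* ℂ, ({φ : K →+* ℂ | φ ∈ Φ.1 ∧ φ.comp (algebraMap k₀ K) = ψ}.ncard : ℂ) * ψ a =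
      cmTypeTrace Φ (algebraMap k₀ K a) := by
  classical
  haveI : Fintype Φ.1 := (Set.toFinite Φ.1).fintype
  rw [cmTypeTrace_eq_sum_subtype_st Φ]
  have h := Fintype.sum_fiberwise' (fun σ : Φ.1 => σ.1.comp (algebraMap k₀ K)) (fun ψ : k₀ →+* ℂ => (ψ a : ℂ))
  simp only [RingHom.comp_apply] at h
  rw [← h]
  refine Finset.sum_congr rfl fun ψ _ => ?_
  rw [Finset.sum_const, Finset.card_univ, nsmul_eq_mul, ncard_inter_fibre_eq_card_fibre_st]

/-- `K* = ℚ(tr_Φ)` is finite over `ℚ`. [folklore] -/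
private theorem finiteDimensional_traceField_st {E : Type} [Field E] [NumberField E] (Ψ : CMType E) :
    FiniteDimensional ℚ (traceField Ψ) :=
  Module.finite_of_finrank_pos (finrank_traceField_pos Ψ)

/-- The image of an embedding of a number field is finite over `ℚ`. [folklore] -/
private theorem finiteDimensional_fieldRange_st {E : Type} [Field E] [NumberField E] (s : E →+* ℂ) :
    FiniteDimensional ℚ s.toRatAlgHom.fieldRange :=
  LinearEquiv.finiteDimensional (AlgEquiv.ofInjectiveField s.toRatAlgHom).toLinearEquiv

/-- A subfield of a number field inside `ℂ` is a number field. [folklore] -/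
private theorem finiteDimensional_of_le_st {E E' : IntermediateField ℚ ℂ} [FiniteDimensional ℚ E] (h : E' ≤ E) :
    FiniteDimensional ℚ E' :=
  FiniteDimensional.of_injective (IntermediateField.inclusion h).toLinearMap (IntermediateField.inclusion_injective h)

/-- `A ≤ B` inside `ℂ` `⟹ [A : ℚ] ∣ [B : ℚ]`. [cite: MilneFT2022, Prop. 1.20] -/
private theorem finrank_dvd_of_le_st {A B : IntermediateField ℚ ℂ} (h : A ≤ B) : finrank ℚ A ∣ finrank ℚ B :=
  Dvd.intro _ (IntermediateField.finrank_bot_mul_relfinrank h)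

end Prelim

/-! ## §1 `ℚ(tr_Φ(a) ∣ a ∈ k₀)` is Kottwitz's reflex field of the `k₀`-signature of `Φ` -/

section Subfield

variable (Φ : CMType K)

/-- **`ℚ(tr_Φ(k₀)) = E_m`**: the field generated by the type traces of the elements of `k₀` is Kottwitz's reflex field
`ℚ(∑_ψ m_ψ ψ(a) ∣ a ∈ k₀)` of the `k₀`-signature `m` (`∑_ψ m_ψ ψ(a) = tr_Φ(a)`: «`M` restricted to `F` is the direct sum of
the `φᵢ`»). [cite: Kottwitz1992, §5 pp. 389–390] [cite: Shimura1998, §5.2 p. 39] -/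
theorem adjoin_cmTypeTrace_algebraMap_eq_adjoin_sum :
    IntermediateField.adjoin ℚ (Set.range fun a : k₀ => cmTypeTrace Φ (algebraMap k₀ K a)) =
      IntermediateField.adjoin ℚ (Set.range fun a : k₀ => ∑ ψ : k₀ →+* ℂ,
        (({φ : K →+* ℂ | φ ∈ Φ.1 ∧ φ.comp (algebraMap k₀ K) = ψ}.ncard : ℕ) : ℂ) * ψ a) := by
  have h : (fun a : k₀ => cmTypeTrace Φ (algebraMap k₀ K a)) = fun a : k₀ => ∑ ψ : k₀ →+* ℂ,
      (({φ : K →+* ℂ | φ ∈ Φ.1 ∧ φ.comp (algebraMap k₀ K) = ψ}.ncard : ℕ) : ℂ) * ψ a :=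
    funext fun a => (sum_ncard_mul_apply_eq_cmTypeTrace_st k₀ Φ a).symm
  rw [h]

/-- **`ℚ(tr_Φ(k₀)) ⊆ K* = ℚ(tr_Φ(K))`.** [cite: Shimura1998, §8.3 Prop. 28] [cite: Kottwitz1992, §5 p. 390] -/
theorem adjoin_cmTypeTrace_algebraMap_le_traceField :
    IntermediateField.adjoin ℚ (Set.range fun a : k₀ => cmTypeTrace Φ (algebraMap k₀ K a)) ≤ traceField Φ := by
  rw [IntermediateField.adjoin_le_iff]
  rintro _ ⟨a, rfl⟩
  exact cmTypeTrace_mem_traceField Φ _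

/-- **Monotonicity**: `k₀ ≤ k₁ ⟹ ℚ(tr_Φ(k₀)) ⊆ ℚ(tr_Φ(k₁))`. [cite: Shimura1998, §8.3 Prop. 28] -/
theorem adjoin_cmTypeTrace_algebraMap_mono {k₁ : IntermediateField ℚ K} (h : k₀ ≤ k₁) :
    IntermediateField.adjoin ℚ (Set.range fun a : k₀ => cmTypeTrace Φ (algebraMap k₀ K a)) ≤
      IntermediateField.adjoin ℚ (Set.range fun a : k₁ => cmTypeTrace Φ (algebraMap k₁ K a)) := by
  rw [IntermediateField.adjoin_le_iff]
  rintro _ ⟨a, rfl⟩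
  exact IntermediateField.subset_adjoin ℚ _ ⟨⟨a.1, h a.2⟩, rfl⟩

/-- **`Aut(ℂ/ℚ(tr_Φ(k₀))) = Stab(m)`** — `τ` fixes the field generated by the type traces of `k₀` pointwise iff it preserves the
`k₀`-signature: `m_{τψ} = m_ψ` for every `ψ` («the field of definition of the isomorphism class of `V₁`» as a
`k₀ ⊗ ℂ`-module). [cite: Kottwitz1992, §5 pp. 389–390] [cite: MilneCM2006, Ch. I §1 Prop. 1.16 (Dedekind)] -/
theorem forall_mem_adjoin_cmTypeTrace_algebraMap_iff (τ : ℂ ≃+* ℂ) :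
    (∀ z : ℂ, z ∈ IntermediateField.adjoin ℚ (Set.range fun a : k₀ => cmTypeTrace Φ (algebraMap k₀ K a)) → τ z = z) ↔
      ∀ ψ : k₀ →+* ℂ, {φ : K →+* ℂ | φ ∈ Φ.1 ∧ φ.comp (algebraMap k₀ K) = τ • ψ}.ncard =
        {φ : K →+* ℂ | φ ∈ Φ.1 ∧ φ.comp (algebraMap k₀ K) = ψ}.ncard := by
  rw [adjoin_cmTypeTrace_algebraMap_eq_adjoin_sum, forall_mem_adjoin_sum_iff]

/-- **`ℚ(tr_Φ(k₀))` IS THE FIXED FIELD OF `Stab(m)`.** [cite: Kottwitz1992, §5 pp. 389–390] [cite: Lang2002, Ch. VIII §1] -/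
theorem mem_adjoin_cmTypeTrace_algebraMap_iff_forall (z : ℂ) :
    z ∈ IntermediateField.adjoin ℚ (Set.range fun a : k₀ => cmTypeTrace Φ (algebraMap k₀ K a)) ↔
      ∀ τ : ℂ ≃+* ℂ, (∀ ψ : k₀ →+* ℂ, {φ : K →+* ℂ | φ ∈ Φ.1 ∧ φ.comp (algebraMap k₀ K) = τ • ψ}.ncard =
        {φ : K →+* ℂ | φ ∈ Φ.1 ∧ φ.comp (algebraMap k₀ K) = ψ}.ncard) → τ z = z := by
  rw [adjoin_cmTypeTrace_algebraMap_eq_adjoin_sum, mem_adjoin_sum_iff_forall]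

/-- `ℚ(tr_Φ(k₀))` is a number field. [cite: Kottwitz1992, §5 p. 390] -/
theorem finiteDimensional_adjoin_cmTypeTrace_algebraMap :
    FiniteDimensional ℚ (IntermediateField.adjoin ℚ (Set.range fun a : k₀ => cmTypeTrace Φ (algebraMap k₀ K a))) :=
  haveI := finiteDimensional_traceField_st Φ
  finiteDimensional_of_le_st (adjoin_cmTypeTrace_algebraMap_le_traceField k₀ Φ)

/-- `[ℚ(tr_Φ(k₀)) : ℚ] ∣ [K* : ℚ]`. [cite: MilneFT2022, Prop. 1.20] [cite: Shimura1998, §8.3 Prop. 28] -/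
theorem finrank_adjoin_cmTypeTrace_algebraMap_dvd :
    finrank ℚ (IntermediateField.adjoin ℚ (Set.range fun a : k₀ => cmTypeTrace Φ (algebraMap k₀ K a))) ∣
      finrank ℚ (traceField Φ) :=
  finrank_dvd_of_le_st (adjoin_cmTypeTrace_algebraMap_le_traceField k₀ Φ)

/-- `Aut(ℂ/K*) ≤ Aut(ℂ/ℚ(tr_Φ(k₀)))`: **`τΦ = Φ ⟹ τ` fixes every `tr_Φ(a)`, `a ∈ k₀`** (indeed every type trace).
[cite: Shimura1998, §8.3 Prop. 28] -/
theorem forall_mem_adjoin_cmTypeTrace_algebraMap_of_forall_smul_mem_iff {τ : ℂ ≃+* ℂ}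
    (hτ : ∀ χ : K →+* ℂ, τ • χ ∈ Φ.1 ↔ χ ∈ Φ.1) :
    ∀ z : ℂ, z ∈ IntermediateField.adjoin ℚ (Set.range fun a : k₀ => cmTypeTrace Φ (algebraMap k₀ K a)) → τ z = z :=
  fun z hz => forall_apply_eq_of_forall_smul_mem_iff τ Φ hτ z (adjoin_cmTypeTrace_algebraMap_le_traceField k₀ Φ hz)

end Subfield

/-! ## §2 `K` CM, the Kottwitz condition relative to `(Φ₀, φ₀)`: `ℚ(tr_Φ(k₀)) = E = E_{Φ₀} · φ₀(k₀)` -/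

section RSZ

variable [IsCMField K] {Φ : CMType K} {Φ₀ : CMType k₀} {φ₀ : k₀ →+* ℂ}
  (hφ₀ : φ₀ ∈ Φ₀.1)
  (h1 : {φ : K →+* ℂ | φ ∈ Φ.1 ∧ φ.comp (algebraMap k₀ K) = φ₀}.ncard = 1)
  (hΦ₀ : ∀ ψ : k₀ →+* ℂ, ψ ∈ Φ₀.1 → ψ ≠ φ₀ → {φ : K →+* ℂ | φ ∈ Φ.1 ∧ φ.comp (algebraMap k₀ K) = ψ}.ncard = 0)

include hΦ₀ in
/-- **`Stab(Φ₀) ∩ Stab(φ₀) ≤ Stab(m)`** (any `n`; `K` CM so that `τψ̄ = \overline{τψ}` on `Hom(k₀, ℂ)`): if `τΦ₀ = Φ₀` and `τφ₀ = φ₀`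
then `m_{τψ} = m_ψ` for every `ψ` — on `Φ₀`: `τ` fixes `φ₀` and permutes `Φ₀ ∖ {φ₀}` where `m = 0`; off `Φ₀`: `m_ψ = n − m_ψ̄`.
(g28-#1's `apply_smul_eq_of_forall_smul_mem_iff_of_smul_eq` needs the field of `r` to be CM; here `k₀` is only a subfield of
the CM field `K`.) [cite: RapoportSmithlingZhang2017, Introduction p. 2 and §3.1 eq. (3.1)] -/
theorem ncard_inter_fibre_smul_eq_of_forall_smul_mem_iff_base_of_smul_eq {τ : ℂ ≃+* ℂ}
    (hτ₀ : ∀ ψ : k₀ →+* ℂ, τ • ψ ∈ Φ₀.1 ↔ ψ ∈ Φ₀.1) (hτφ₀ : τ • φ₀ = φ₀) (ψ : k₀ →+* ℂ) :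
    {φ : K →+* ℂ | φ ∈ Φ.1 ∧ φ.comp (algebraMap k₀ K) = τ • ψ}.ncard =
      {φ : K →+* ℂ | φ ∈ Φ.1 ∧ φ.comp (algebraMap k₀ K) = ψ}.ncard := by
  -- on `Φ₀`
  have aux : ∀ χ : k₀ →+* ℂ, χ ∈ Φ₀.1 →
      {φ : K →+* ℂ | φ ∈ Φ.1 ∧ φ.comp (algebraMap k₀ K) = τ • χ}.ncard =
        {φ : K →+* ℂ | φ ∈ Φ.1 ∧ φ.comp (algebraMap k₀ K) = χ}.ncard := fun χ hχ => by
    by_cases h : χ = φ₀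
    · rw [h, hτφ₀]
    · have hne : τ • χ ≠ φ₀ := fun h' => h (smul_left_cancel τ (h'.trans hτφ₀.symm))
      rw [hΦ₀ _ ((hτ₀ χ).2 hχ) hne, hΦ₀ χ hχ h]
  by_cases hψ : ψ ∈ Φ₀.1
  · exact aux ψ hψ
  · -- off `Φ₀`: `m_χ = n − m_χ̄` for every `χ`, and `ψ̄ ∈ Φ₀`
    have hbar : ComplexEmbedding.conjugate ψ ∈ Φ₀.1 := (Φ₀.2 _).2 (by rwa [conjugate_conjugate_st])
    rw [ncard_inter_fibre_eq_sub k₀ Φ (τ • ψ), ncard_inter_fibre_eq_sub k₀ Φ ψ, ← smul_conjugate_base_st, aux _ hbar]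

include hφ₀ h1 hΦ₀ in
/-- **`Stab(m) ∩ Stab(Φ₀) = Stab(Φ₀) ∩ Stab(φ₀)`** for the `k₀`-signature under the Kottwitz condition (any `n`).
[cite: RapoportSmithlingZhang2017, Introduction p. 2 and §3.1 eq. (3.1)] -/
theorem forall_ncard_inter_fibre_smul_eq_and_iff_of_rsz (τ : ℂ ≃+* ℂ) :
    ((∀ ψ : k₀ →+* ℂ, {φ : K →+* ℂ | φ ∈ Φ.1 ∧ φ.comp (algebraMap k₀ K) = τ • ψ}.ncard =
        {φ : K →+* ℂ | φ ∈ Φ.1 ∧ φ.comp (algebraMap k₀ K) = ψ}.ncard) ∧ ∀ ψ : k₀ →+* ℂ, τ • ψ ∈ Φ₀.1 ↔ ψ ∈ Φ₀.1) ↔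
      (∀ ψ : k₀ →+* ℂ, τ • ψ ∈ Φ₀.1 ↔ ψ ∈ Φ₀.1) ∧ τ • φ₀ = φ₀ :=
  ⟨fun h => ⟨h.2, smul_eq_of_forall_apply_smul_eq_of_forall_smul_mem_iff
      (r := fun χ => {φ : K →+* ℂ | φ ∈ Φ.1 ∧ φ.comp (algebraMap k₀ K) = χ}.ncard) hφ₀ h1 hΦ₀ h.1 h.2⟩,
    fun h => ⟨ncard_inter_fibre_smul_eq_of_forall_smul_mem_iff_base_of_smul_eq k₀ hΦ₀ h.1 h.2, h.1⟩⟩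

include hφ₀ h1 hΦ₀ in
/-- **`ℚ(tr_Φ(k₀)) · E_{Φ₀} = E_{Φ₀} · φ₀(k₀)`** (any `n`) — «the composite of the reflex field of `r` and the reflex field of `Φ`»
for the signature `r = m` of a CM point. [cite: RapoportSmithlingZhang2017, Introduction p. 2] [cite: RapoportSmithlingZhang2017, §3.1 eq. (3.1)]
[cite: Kottwitz1992, §5 p. 390] [cite: Lang2002, Ch. VIII §1] -/
theorem adjoin_cmTypeTrace_algebraMap_sup_eq_of_rsz :
    IntermediateField.adjoin ℚ (Set.range fun a : k₀ => cmTypeTrace Φ (algebraMap k₀ K a)) ⊔ traceField Φ₀ =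
      traceField Φ₀ ⊔ φ₀.toRatAlgHom.fieldRange := by
  haveI := finiteDimensional_adjoin_cmTypeTrace_algebraMap k₀ Φ
  haveI := finiteDimensional_traceField_st Φ₀
  haveI := finiteDimensional_fieldRange_st φ₀
  haveI : FiniteDimensional ℚ (IntermediateField.adjoin ℚ (Set.range fun a : k₀ => cmTypeTrace Φ (algebraMap k₀ K a)) ⊔
      traceField Φ₀ : IntermediateField ℚ ℂ) := IntermediateField.finiteDimensional_sup _ _
  haveI : FiniteDimensional ℚ (traceField Φ₀ ⊔ φ₀.toRatAlgHom.fieldRange : IntermediateField ℚ ℂ) :=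
    IntermediateField.finiteDimensional_sup _ _
  refine eq_of_forall_forall_mem_iff fun τ => ?_
  rw [forall_mem_sup_iff, forall_mem_adjoin_cmTypeTrace_algebraMap_iff, ← forall_smul_mem_iff_iff_forall_apply_traceField_eq,
    forall_ncard_inter_fibre_smul_eq_and_iff_of_rsz k₀ hφ₀ h1 hΦ₀ τ, forall_mem_traceField_sup_fieldRange_iff]

include hφ₀ h1 hΦ₀ in
/-- **`n ≥ 3`: `Stab(m) = Stab(Φ₀) ∩ Stab(φ₀)`** for the `k₀`-signature of a CM point. [cite: RapoportSmithlingZhang2017, Introduction p. 2]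
[cite: RapoportSmithlingZhang2017, §3.1 eq. (3.1)] -/
theorem forall_ncard_inter_fibre_smul_eq_iff_of_rsz (h3 : 3 ≤ finrank k₀ K) (τ : ℂ ≃+* ℂ) :
    (∀ ψ : k₀ →+* ℂ, {φ : K →+* ℂ | φ ∈ Φ.1 ∧ φ.comp (algebraMap k₀ K) = τ • ψ}.ncard =
        {φ : K →+* ℂ | φ ∈ Φ.1 ∧ φ.comp (algebraMap k₀ K) = ψ}.ncard) ↔
      (∀ ψ : k₀ →+* ℂ, τ • ψ ∈ Φ₀.1 ↔ ψ ∈ Φ₀.1) ∧ τ • φ₀ = φ₀ := by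
  refine ⟨fun hm => ⟨?_, ?_⟩, fun h => ncard_inter_fibre_smul_eq_of_forall_smul_mem_iff_base_of_smul_eq k₀ hΦ₀ h.1 h.2⟩
  · exact forall_smul_mem_iff_of_forall_apply_smul_eq
      (r := fun χ => {φ : K →+* ℂ | φ ∈ Φ.1 ∧ φ.comp (algebraMap k₀ K) = χ}.ncard) hφ₀ h1 hΦ₀
      (fun χ _ => ncard_inter_fibre_eq_sub k₀ Φ χ) h3 hm
  · exact smul_eq_of_forall_apply_smul_eq
      (r := fun χ => {φ : K →+* ℂ | φ ∈ Φ.1 ∧ φ.comp (algebraMap k₀ K) = χ}.ncard) hφ₀ h1 hΦ₀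
      (fun χ _ => ncard_inter_fibre_eq_sub k₀ Φ χ) h3 hm

include hφ₀ h1 hΦ₀ in
/-- **`n ≥ 3`: `ℚ(tr_Φ(a) ∣ a ∈ k₀) = E_{Φ₀} · φ₀(k₀) = E`** — THE REFLEX FIELD OF RSZ's SHIMURA DATUM IS THE FIELD GENERATED BY THE
TYPE TRACES OF THE ELEMENTS OF `k₀`, for the type `Φ` of ANY CM point of the moduli problem (`Stab(m) = Stab(Φ₀) ∩ Stab(φ₀) =
Aut(ℂ/E)`, both number fields). [cite: RapoportSmithlingZhang2017, Introduction p. 2] [cite: RapoportSmithlingZhang2017, §3.1 eq. (3.1) and §3.2]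
[cite: Kottwitz1992, §5 pp. 389–390] [cite: Lang2002, Ch. VIII §1] -/
theorem adjoin_cmTypeTrace_algebraMap_eq_of_rsz (h3 : 3 ≤ finrank k₀ K) :
    IntermediateField.adjoin ℚ (Set.range fun a : k₀ => cmTypeTrace Φ (algebraMap k₀ K a)) =
      traceField Φ₀ ⊔ φ₀.toRatAlgHom.fieldRange := by
  haveI := finiteDimensional_adjoin_cmTypeTrace_algebraMap k₀ Φ
  haveI := finiteDimensional_traceField_st Φ₀
  haveI := finiteDimensional_fieldRange_st φ₀
  haveI : FiniteDimensional ℚ (traceField Φ₀ ⊔ φ₀.toRatAlgHom.fieldRange : IntermediateField ℚ ℂ) :=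
    IntermediateField.finiteDimensional_sup _ _
  refine eq_of_forall_forall_mem_iff fun τ => ?_
  rw [forall_mem_adjoin_cmTypeTrace_algebraMap_iff, forall_ncard_inter_fibre_smul_eq_iff_of_rsz k₀ hφ₀ h1 hΦ₀ h3,
    forall_mem_traceField_sup_fieldRange_iff]

include hφ₀ h1 hΦ₀ in
/-- `n ≥ 3`: **`E_{Φ₀} ⊆ ℚ(tr_Φ(k₀))`**. [cite: RapoportSmithlingZhang2017, §3.1 Remark 3.1 (i)] -/
theorem traceField_base_le_adjoin_cmTypeTrace_algebraMap_of_rsz (h3 : 3 ≤ finrank k₀ K) :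
    traceField Φ₀ ≤ IntermediateField.adjoin ℚ (Set.range fun a : k₀ => cmTypeTrace Φ (algebraMap k₀ K a)) := by
  rw [adjoin_cmTypeTrace_algebraMap_eq_of_rsz k₀ hφ₀ h1 hΦ₀ h3]
  exact le_sup_left

include hφ₀ h1 hΦ₀ in
/-- `n ≥ 3`: **`φ₀(a) ∈ ℚ(tr_Φ(k₀))`** — the distinguished embedding takes values in the field generated by the type traces of
`k₀` («`E` contains `F` via `φ₀`»). [cite: RapoportSmithlingZhang2017, §3.1 (after eq. (3.1))] -/
theorem apply_mem_adjoin_cmTypeTrace_algebraMap_of_rsz (h3 : 3 ≤ finrank k₀ K) (a : k₀) :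
    φ₀ a ∈ IntermediateField.adjoin ℚ (Set.range fun x : k₀ => cmTypeTrace Φ (algebraMap k₀ K x)) := by
  rw [adjoin_cmTypeTrace_algebraMap_eq_of_rsz k₀ hφ₀ h1 hΦ₀ h3]
  exact apply_mem_traceField_sup_fieldRange Φ₀ φ₀ a

include hφ₀ h1 hΦ₀ in
/-- `n ≥ 3`: **`ℚ(tr_Φ(k₀)) = E ⊆ K* = ℚ(tr_Φ(K)) = E_{Φ₀} · σ₀(K)`** — with g28-#2: the inclusion of the `k₀`-trace field in the
`K`-trace field is `E ⊆ K*`. [cite: RapoportSmithlingZhang2017, §3.1 eq. (3.1) and §3.2] [cite: Howard2012, §3.1] -/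
theorem adjoin_cmTypeTrace_algebraMap_eq_and_le_of_rsz (h3 : 3 ≤ finrank k₀ K) {σ₀ : K →+* ℂ} (hσ₀ : σ₀ ∈ Φ.1)
    (hσ₀ψ : σ₀.comp (algebraMap k₀ K) = φ₀) :
    IntermediateField.adjoin ℚ (Set.range fun a : k₀ => cmTypeTrace Φ (algebraMap k₀ K a)) =
        traceField Φ₀ ⊔ φ₀.toRatAlgHom.fieldRange ∧
      traceField Φ = traceField Φ₀ ⊔ σ₀.toRatAlgHom.fieldRange ∧
        IntermediateField.adjoin ℚ (Set.range fun a : k₀ => cmTypeTrace Φ (algebraMap k₀ K a)) ≤ traceField Φ :=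
  ⟨adjoin_cmTypeTrace_algebraMap_eq_of_rsz k₀ hφ₀ h1 hΦ₀ h3,
    traceField_eq_traceField_sup_fieldRange_of_rsz k₀ hφ₀ h1 hΦ₀ h3 hσ₀ hσ₀ψ,
    adjoin_cmTypeTrace_algebraMap_le_traceField k₀ Φ⟩

include hφ₀ h1 hΦ₀ in
/-- `n ≥ 3`: `[E : ℚ] = [ℚ(tr_Φ(k₀)) : ℚ]` divides `[K* : ℚ]`. [cite: MilneFT2022, Prop. 1.20] -/
theorem finrank_traceField_sup_fieldRange_eq_finrank_adjoin_of_rsz (h3 : 3 ≤ finrank k₀ K) :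
    finrank ℚ (traceField Φ₀ ⊔ φ₀.toRatAlgHom.fieldRange : IntermediateField ℚ ℂ) =
      finrank ℚ (IntermediateField.adjoin ℚ (Set.range fun a : k₀ => cmTypeTrace Φ (algebraMap k₀ K a))) := by
  rw [adjoin_cmTypeTrace_algebraMap_eq_of_rsz k₀ hφ₀ h1 hΦ₀ h3]

end RSZ

/-! ## §3 Through the Harris–Taylor hypotheses `(h1, hban)` -/

section HarrisTaylor

variable [IsCMField K] {Φ : CMType K} {φ₀ : k₀ →+* ℂ}
  (h1 : {φ : K →+* ℂ | φ ∈ Φ.1 ∧ φ.comp (algebraMap k₀ K) = φ₀}.ncard = 1)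
  (hban : ∀ ψ : k₀ →+* ℂ, ψ ≠ φ₀ → ψ ≠ ComplexEmbedding.conjugate φ₀ →
    {φ : K →+* ℂ | φ ∈ Φ.1 ∧ φ.comp (algebraMap k₀ K) = ψ}.ncard = 0 ∨
      {φ : K →+* ℂ | φ ∈ Φ.1 ∧ φ.comp (algebraMap k₀ K) = ψ}.ncard = finrank k₀ K)

include h1 hban in
/-- **`n ≥ 3`: for a CM type with the Harris–Taylor multiplicities there is a base type `Φ₀ ∋ φ₀` with
`ℚ(tr_Φ(k₀)) = E_{Φ₀} · φ₀(k₀)`.** [cite: RapoportSmithlingZhang2017, Introduction p. 2 and §3.1 eq. (3.1)] [cite: Howard2012, §3.1] -/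
theorem exists_cmType_adjoin_cmTypeTrace_algebraMap_eq_of_harrisTaylor (h3 : 3 ≤ finrank k₀ K) :
    ∃ Φ₀ : CMType k₀, φ₀ ∈ Φ₀.1 ∧
      IntermediateField.adjoin ℚ (Set.range fun a : k₀ => cmTypeTrace Φ (algebraMap k₀ K a)) =
        traceField Φ₀ ⊔ φ₀.toRatAlgHom.fieldRange := by
  obtain ⟨Φ₀, hφ₀, hΦ₀, -⟩ := exists_cmType_rsz_of_harrisTaylor k₀ h1 hban h3
  exact ⟨Φ₀, hφ₀, adjoin_cmTypeTrace_algebraMap_eq_of_rsz k₀ hφ₀ h1 hΦ₀ h3⟩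

include h1 hban in
/-- `n ≥ 3`: **`φ₀(a) ∈ ℚ(tr_Φ(k₀))`** for every `a ∈ k₀` under the Harris–Taylor hypotheses.
[cite: RapoportSmithlingZhang2017, §3.1 (after eq. (3.1))] [cite: Howard2012, §3.1] -/
theorem apply_mem_adjoin_cmTypeTrace_algebraMap_of_harrisTaylor (h3 : 3 ≤ finrank k₀ K) (a : k₀) :
    φ₀ a ∈ IntermediateField.adjoin ℚ (Set.range fun x : k₀ => cmTypeTrace Φ (algebraMap k₀ K x)) := by
  obtain ⟨Φ₀, hφ₀, hΦ₀, -⟩ := exists_cmType_rsz_of_harrisTaylor k₀ h1 hban h3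
  exact apply_mem_adjoin_cmTypeTrace_algebraMap_of_rsz k₀ hφ₀ h1 hΦ₀ h3 a

include h1 hban in
/-- `n ≥ 3`: **`φ₀(k₀) ⊆ ℚ(tr_Φ(k₀))`**. [cite: RapoportSmithlingZhang2017, §3.1 (after eq. (3.1))] -/
theorem fieldRange_le_adjoin_cmTypeTrace_algebraMap_of_harrisTaylor (h3 : 3 ≤ finrank k₀ K) :
    φ₀.toRatAlgHom.fieldRange ≤ IntermediateField.adjoin ℚ (Set.range fun x : k₀ => cmTypeTrace Φ (algebraMap k₀ K x)) := by
  intro z hz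
  obtain ⟨a, rfl⟩ := AlgHom.mem_fieldRange.1 hz
  exact apply_mem_adjoin_cmTypeTrace_algebraMap_of_harrisTaylor k₀ h1 hban h3 a

include h1 hban in
/-- `n ≥ 3`: **`[k₀ : ℚ] ∣ [ℚ(tr_Φ(k₀)) : ℚ]`**. [cite: MilneFT2022, Prop. 1.20] -/
theorem finrank_dvd_finrank_adjoin_cmTypeTrace_algebraMap_of_harrisTaylor (h3 : 3 ≤ finrank k₀ K) :
    finrank ℚ k₀ ∣ finrank ℚ (IntermediateField.adjoin ℚ (Set.range fun x : k₀ => cmTypeTrace Φ (algebraMap k₀ K x))) := by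
  have h := finrank_dvd_of_le_st (fieldRange_le_adjoin_cmTypeTrace_algebraMap_of_harrisTaylor k₀ h1 hban h3)
  rwa [show finrank ℚ φ₀.toRatAlgHom.fieldRange = finrank ℚ k₀ by
    rw [← IntermediateField.finrank_eq_finrank_subalgebra, AlgHom.fieldRange_toSubalgebra]
    exact (AlgEquiv.ofInjectiveField φ₀.toRatAlgHom).toLinearEquiv.finrank_eq.symm] at h

end HarrisTaylor

end Literature.NumberTheory.ComplexMultiplication

end
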